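import Mathlib.Analysis.InnerProductSpace.PiL2
import Mathlib.Analysis.Complex.Trigonometric
import Mathlib.GroupTheory.SemidirectProduct
import Mathlib.LinearAlgebra.Determinant
import Mathlib.Analysis.Distribution.SchwartzSpace.Basic
import Mathlib.Topology.Algebra.Module.Equiv
import Mathlib.Topology.Algebra.Module.FiniteDimension
import HarnessLib

-- provenance: harness21/H21/H21/Prelude/QLatticeAQFT/MinkowskiGeometry.lean @ aa00374 (interim HEAD d8f2665); M5 mechanical rewrite
/-!
# Minkowski space, the Lorentz group and the Poincaré group

Trunk `QLatticeAQFT` (G13), item A15 / notion `minkowski_poincare_group`, outline decision A-D4.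

We set up `(d+1)`-dimensional Minkowski space-time as the type
`SpaceTime d := EuclideanSpace ℝ (Fin (d + 1))` (time index `0`, space indices `i.succ`), the
Minkowski form `η` of signature `(+, −, …, −)`, the causal vocabulary (timelike / spacelike /
lightlike vectors, forward light cones, spacelike separation), the Lorentz group as a subgroup of
`SpaceTime d ≃L[ℝ] SpaceTime d` together with its proper, orthochronous and restricted subgroups,
boosts and spatial rotations, the Poincaré group as a Mathlib `SemidirectProduct`, its action on
space-time and the induced action on Schwartz test functions (in one and in `n` variables).

Sources: R. F. Streater, A. S. Wightman, *PCT, Spin and Statistics, and All That* (1964), §1-1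
(Lorentz and Poincaré groups), §1-3, §3-1; R. Haag, *Local Quantum Physics* (1996), §I.2.1.
Design reference: the `physlib`/`PhysLean` directory `Relativity/` (Lorentz group as the
stabiliser of `η`, orthochronous / proper components).

## Mathlib

Mathlib (pinned) has `EuclideanSpace`, `EuclideanSpace.proj`, `ContinuousLinearMap.smulRight`,
the group structure `ContinuousLinearEquiv.automorphismGroup` on `E ≃L[R] E`, `LinearMap.det`,
`MonoidHom.ker`, `SemidirectProduct` (`N ⋊[φ] G`), `MulAut`, `Multiplicative`,
`AddEquiv.toMultiplicative`, and on Schwartz space `SchwartzMap.compCLMOfContinuousLinearEquiv`,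
`SchwartzMap.compSubConstCLM`. It has no Minkowski form, Lorentz group or Poincaré group
(`rg -i lorentz` in Mathlib only hits unrelated files); everything below is a thin layer.

## Design choices

* `SpaceTime d = EuclideanSpace ℝ (Fin (d + 1))` so that `SpaceTime 3 = Lorentz.E4` (trunk G08)
  holds by `rfl` and G07's `UnitaryRep (Multiplicative P) H` / `HasFourierSpectrumIn` apply with
  `P := SpaceTime d`. This file does **not** import G08; the bridge
  `minkowskiForm 3 = -Lorentz.Minkowski.bilin` is the separate item `MinkowskiLorentzBridge`.
  The Euclidean norm on `SpaceTime d` is used only for topology and for the Schwartz class.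
* Signature `(+, −, …, −)` (Streater–Wightman); G08 (`Lorentz.Minkowski.bilin`) uses
  `(−, +, +, +)`.
* `minkowskiForm d` is built in G08's `smulRight` style from coordinate covectors, so that
  `minkowskiForm_apply` is `simp`.
* The Lorentz group is a `Subgroup (SpaceTime d ≃L[ℝ] SpaceTime d)`; properness is the kernel of
  the determinant `detHom d`, a `MonoidHom`, and the restricted Lorentz group is the intersection
  of the orthochronous Lorentz group with that kernel. The Poincaré group is the Mathlib
  semidirect product `Multiplicative (SpaceTime d) ⋊[lorentzAct] restrictedLorentzGroup d`, with
  **no topology** (A-D4): Wightman data carry a unitary representation of translations and a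
  homomorphism of `restrictedLorentzGroup d` separately. No universal cover (v0 fields are
  scalar).
* `poincareTest g f = f ∘ (poincareAct g⁻¹)`, i.e. `(g • f)(x) = f(Λ⁻¹ (x − a))`, the left action
  on test functions.
-/

noncomputable section

open scoped BigOperators SchwartzMap

namespace Literature.MathematicalPhysics.QuantumLattice

/-! ### Space-time and coordinates -/

/-- `(d+1)`-dimensional Minkowski space-time as a real vector space, `ℝ^{1+d}`, index `0` = time,
indices `1, …, d` = space (Streater–Wightman (1964), §1-1). The Euclidean structure is only used
for the topology; the Lorentzian structure is `minkowskiForm d`. [cite: StreaterWightman1964] -/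
abbrev SpaceTime (d : ℕ) : Type := EuclideanSpace ℝ (Fin (d + 1))

variable {d : ℕ}

/-- The time coordinate `x⁰ = x 0` of a space-time point (Streater–Wightman (1964), §1-1). [cite: StreaterWightman1964] -/
def timeC (x : SpaceTime d) : ℝ := x 0

/-- Unfolding lemma for `timeC`. [folklore] -/
@[simp]
theorem timeC_apply (x : SpaceTime d) : timeC x = x 0 := rfl

variable (d) in
/-- The spatial part `x⃗ = (x 1, …, x d) ∈ ℝ^d` of a space-time point, as a continuous linear map
dropping the index `0` (Streater–Wightman (1964), §1-1). [cite: StreaterWightman1964] -/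
def spaceC : SpaceTime d →L[ℝ] EuclideanSpace ℝ (Fin d) :=
  ((EuclideanSpace.equiv (Fin d) ℝ).symm : (Fin d → ℝ) →L[ℝ] EuclideanSpace ℝ (Fin d)).comp
    (ContinuousLinearMap.pi fun i : Fin d => EuclideanSpace.proj (𝕜 := ℝ) i.succ)

/-- Components of `spaceC`: the `i`-th spatial coordinate is `x (i+1)`. [folklore] -/
@[simp]
theorem spaceC_apply (x : SpaceTime d) (i : Fin d) : spaceC d x i = x i.succ := rfl

/-- Assemble a space-time point from a time `t` and a spatial point `y`:
`ofTimeSpace t y = (t, y 0, …, y (d-1))` (Streater–Wightman (1964), §1-1). [cite: StreaterWightman1964] -/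
def ofTimeSpace (t : ℝ) (y : EuclideanSpace ℝ (Fin d)) : SpaceTime d :=
  WithLp.toLp 2 (Fin.cons t (WithLp.ofLp y))

/-- Component `0` of `(t, y)` is `t`. [folklore] -/
@[simp]
theorem ofTimeSpace_apply_zero (t : ℝ) (y : EuclideanSpace ℝ (Fin d)) :
    ofTimeSpace t y 0 = t := rfl

/-- Component `i+1` of `(t, y)` is `y i`. [folklore] -/
@[simp]
theorem ofTimeSpace_apply_succ (t : ℝ) (y : EuclideanSpace ℝ (Fin d)) (i : Fin d) :
    ofTimeSpace t y i.succ = y i := by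
  simp [ofTimeSpace]

/-- The spatial part of `(t, y)` is `y`. [folklore] -/
@[simp]
theorem spaceC_ofTimeSpace (t : ℝ) (y : EuclideanSpace ℝ (Fin d)) :
    spaceC d (ofTimeSpace t y) = y := by
  ext i; simp

/-- Every space-time point is `(x⁰, x⃗)`. [folklore] -/
@[simp]
theorem ofTimeSpace_apply_zero_spaceC (x : SpaceTime d) : ofTimeSpace (x 0) (spaceC d x) = x := by
  ext i
  refine Fin.cases ?_ (fun j => ?_) i <;> simp

variable (d) in
/-- The unit time vector `e₀ = (1, 0, …, 0)` (Mathlib's `EuclideanSpace.single 0 1`;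
Streater–Wightman (1964), §1-1). [cite: StreaterWightman1964] -/
def e₀ : SpaceTime d := EuclideanSpace.single 0 1

/-- Components of `e₀`. [folklore] -/
@[simp]
theorem e₀_apply (i : Fin (d + 1)) : e₀ d i = if i = 0 then 1 else 0 := by
  simp [e₀]

/-! ### The Minkowski form -/

variable (d) in
/-- The **Minkowski form** `η(v, w) = v⁰ w⁰ − ∑ᵢ vⁱ wⁱ` on `SpaceTime d`, signature
`(+, −, …, −)`, as a continuous bilinear form `dx⁰ ⊗ dx⁰ − ∑ᵢ dxⁱ ⊗ dxⁱ`
(Streater–Wightman (1964), §1-1, eq. (1-1)). Note: trunk G08's `Lorentz.Minkowski.bilin` uses the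
opposite signature `(−, +, +, +)`; `minkowskiForm 3 = -Lorentz.Minkowski.bilin`. [cite: StreaterWightman1964] -/
def minkowskiForm : SpaceTime d →L[ℝ] SpaceTime d →L[ℝ] ℝ :=
  (EuclideanSpace.proj (0 : Fin (d + 1))).smulRight (EuclideanSpace.proj (0 : Fin (d + 1))) -
    ∑ i : Fin d, (EuclideanSpace.proj i.succ).smulRight (EuclideanSpace.proj i.succ)

/-- Coordinate formula for the Minkowski form (Streater–Wightman (1964), eq. (1-1)). [cite: StreaterWightman1964] -/
@[simp]
theorem minkowskiForm_apply (v w : SpaceTime d) :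
    minkowskiForm d v w = v 0 * w 0 - ∑ i : Fin d, v i.succ * w i.succ := by
  simp [minkowskiForm]

/-- The Minkowski form is symmetric. [folklore] -/
theorem minkowskiForm_comm (v w : SpaceTime d) : minkowskiForm d v w = minkowskiForm d w v := by
  simp [mul_comm]

/-- `η(v, w) = v⁰ w⁰ − ⟪v⃗, w⃗⟫`. [folklore] -/
theorem minkowskiForm_eq_inner (v w : SpaceTime d) :
    minkowskiForm d v w = v 0 * w 0 - inner ℝ (spaceC d v) (spaceC d w) := by
  simp [EuclideanSpace.inner_eq_star_dotProduct, dotProduct, mul_comm]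

/-- `η(v, v) = (v⁰)² − ‖v⃗‖²`. [folklore] -/
theorem minkowskiForm_self (v : SpaceTime d) :
    minkowskiForm d v v = v 0 ^ 2 - ‖spaceC d v‖ ^ 2 := by
  rw [minkowskiForm_eq_inner, real_inner_self_eq_norm_sq, sq, sq]

/-- `η(e₀, e₀) = 1` (provable by `simp`, hence not a simp lemma). [folklore] -/
theorem minkowskiForm_e₀_e₀ : minkowskiForm d (e₀ d) (e₀ d) = 1 := by
  simp

/-- `η(e₀, v) = v⁰` (provable by `simp`, hence not a simp lemma). [folklore] -/
theorem minkowskiForm_e₀_left (v : SpaceTime d) : minkowskiForm d (e₀ d) v = v 0 := by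
  simp

/-! ### Causal vocabulary -/

/-- A vector is *timelike* if `η(v, v) > 0` (Streater–Wightman (1964), §1-1). [cite: StreaterWightman1964] -/
def IsTimelike (v : SpaceTime d) : Prop := 0 < minkowskiForm d v v

/-- A vector is *spacelike* if `η(v, v) < 0` (Streater–Wightman (1964), §1-1). [cite: StreaterWightman1964] -/
def IsSpacelike (v : SpaceTime d) : Prop := minkowskiForm d v v < 0

/-- A vector is *lightlike* (null) if `η(v, v) = 0` (Streater–Wightman (1964), §1-1). [cite: StreaterWightman1964] -/
def IsLightlike (v : SpaceTime d) : Prop := minkowskiForm d v v = 0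

variable (d) in
/-- The open forward light cone `V₊ = {p | p⁰ > 0, η(p, p) > 0}` (Streater–Wightman (1964), §1-1,
§2-3). [cite: StreaterWightman1964] -/
def forwardCone : Set (SpaceTime d) := {p | 0 < p 0 ∧ 0 < minkowskiForm d p p}

variable (d) in
/-- The closed forward light cone `V̄₊ = {p | ‖p⃗‖ ≤ p⁰}` (Streater–Wightman (1964), §3-1,
spectral condition). This is the set handed to G07's `UnitaryRep.HasFourierSpectrumIn`.
*Minkowski vs Euclidean pairing* (repeating G07 `FourierSpectrum`): with the Euclidean inner
product of `SpaceTime d` the physical representation `U(a⁰, a⃗) = e^{i(H a⁰ − P⃗ · a⃗)}` has Fourier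
spectrum `{(p⁰, −p⃗)}`; since `V̄₊` is invariant under `p⃗ ↦ −p⃗` it may be passed verbatim. [cite: StreaterWightman1964] -/
def closedForwardCone : Set (SpaceTime d) := {p | ‖spaceC d p‖ ≤ p 0}

/-- Membership in the closed forward cone. [folklore] -/
@[simp]
theorem mem_closedForwardCone_iff (p : SpaceTime d) :
    p ∈ closedForwardCone d ↔ ‖spaceC d p‖ ≤ p 0 := Iff.rfl

/-- Membership in the open forward cone. [folklore] -/
@[simp]
theorem mem_forwardCone_iff (p : SpaceTime d) :
    p ∈ forwardCone d ↔ 0 < p 0 ∧ 0 < minkowskiForm d p p := Iff.rfl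

/-- The open forward cone in terms of the spatial norm: `‖p⃗‖ < p⁰`. [folklore] -/
theorem mem_forwardCone_iff_norm_lt (p : SpaceTime d) :
    p ∈ forwardCone d ↔ ‖spaceC d p‖ < p 0 := by
  rw [mem_forwardCone_iff, minkowskiForm_self, sub_pos, sq_lt_sq, abs_of_nonneg (norm_nonneg _)]
  constructor
  · rintro ⟨h0, h⟩
    rwa [abs_of_pos h0] at h
  · intro h
    have h0 : 0 < p 0 := (norm_nonneg _).trans_lt h
    exact ⟨h0, by rwa [abs_of_pos h0]⟩

/-- The open forward cone is contained in the closed one. [folklore] -/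
theorem forwardCone_subset_closedForwardCone : forwardCone d ⊆ closedForwardCone d :=
  fun p hp => ((mem_forwardCone_iff_norm_lt p).1 hp).le

/-- The closed forward cone is closed. [folklore] -/
theorem isClosed_closedForwardCone : IsClosed (closedForwardCone d) :=
  isClosed_le (spaceC d).continuous.norm (EuclideanSpace.proj (0 : Fin (d + 1))).continuous

/-- Two points are *spacelike separated* if `η(x − y, x − y) < 0` (Streater–Wightman (1964),
§3-1, locality axiom). [cite: StreaterWightman1964] -/
def IsSpacelikeSeparated (x y : SpaceTime d) : Prop := IsSpacelike (x - y)

/-- Spacelike separation is symmetric. [folklore] -/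
theorem IsSpacelikeSeparated.symm {x y : SpaceTime d} (h : IsSpacelikeSeparated x y) :
    IsSpacelikeSeparated y x := by
  unfold IsSpacelikeSeparated IsSpacelike at *
  rw [← neg_sub, map_neg, map_neg, _root_.neg_apply, neg_neg]
  exact h

/-- Two regions are *spacelike separated* if all pairs of their points are
(Streater–Wightman (1964), §3-1; Haag (1996), §I.2.1). [cite: StreaterWightman1964] -/
def AreSpacelikeSeparated (s t : Set (SpaceTime d)) : Prop :=
  ∀ x ∈ s, ∀ y ∈ t, IsSpacelikeSeparated x y

/-- Spacelike separation of regions is symmetric. [folklore] -/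
theorem AreSpacelikeSeparated.symm {s t : Set (SpaceTime d)} (h : AreSpacelikeSeparated s t) :
    AreSpacelikeSeparated t s :=
  fun y hy x hx => (h x hx y hy).symm

/-- **Reverse Cauchy–Schwarz.** Two future-pointing timelike vectors have positive Minkowski
product: `η(u, v) > 0` for `u, v ∈ V₊` (Streater–Wightman (1964), §1-1; used for the closure of
the orthochronous Lorentz group). [cite: StreaterWightman1964] -/
theorem minkowskiForm_pos_of_mem_forwardCone {u v : SpaceTime d} (hu : u ∈ forwardCone d)
    (hv : v ∈ forwardCone d) : 0 < minkowskiForm d u v := by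
  rw [mem_forwardCone_iff_norm_lt] at hu hv
  rw [minkowskiForm_eq_inner, sub_pos]
  calc inner ℝ (spaceC d u) (spaceC d v) ≤ ‖spaceC d u‖ * ‖spaceC d v‖ :=
        real_inner_le_norm _ _
    _ < u 0 * v 0 :=
        mul_lt_mul'' hu hv (norm_nonneg _) (norm_nonneg _)

/-! ### The Lorentz group -/

section automorphismGroup

variable {E : Type*} [TopologicalSpace E] [AddCommMonoid E] [Module ℝ E]

/-- Unfolding the group law of `ContinuousLinearEquiv.automorphismGroup`: `(Λ * Λ') x = Λ (Λ' x)`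
(Mathlib defines `f * g := g.trans f`). [folklore] -/
@[simp]
theorem continuousLinearEquiv_mul_apply (Λ Λ' : E ≃L[ℝ] E) (x : E) : (Λ * Λ') x = Λ (Λ' x) :=
  rfl

/-- Unfolding the unit of `ContinuousLinearEquiv.automorphismGroup`. [folklore] -/
@[simp]
theorem continuousLinearEquiv_one_apply (x : E) : (1 : E ≃L[ℝ] E) x = x := rfl

/-- Unfolding the inverse of `ContinuousLinearEquiv.automorphismGroup`: `Λ⁻¹ = Λ.symm`. [folklore] -/
theorem continuousLinearEquiv_inv_def (Λ : E ≃L[ℝ] E) : Λ⁻¹ = Λ.symm := rfl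

/-- `Λ (Λ⁻¹ x) = x`. [folklore] -/
@[simp]
theorem continuousLinearEquiv_apply_inv_apply (Λ : E ≃L[ℝ] E) (x : E) : Λ (Λ⁻¹ x) = x :=
  Λ.apply_symm_apply x

/-- `Λ⁻¹ (Λ x) = x`. [folklore] -/
@[simp]
theorem continuousLinearEquiv_inv_apply_apply (Λ : E ≃L[ℝ] E) (x : E) : Λ⁻¹ (Λ x) = x :=
  Λ.symm_apply_apply x

end automorphismGroup

variable (d) in
/-- The (full) **Lorentz group** `O(1, d)`: continuous linear automorphisms of `SpaceTime d`
preserving the Minkowski form, as a subgroup of `SpaceTime d ≃L[ℝ] SpaceTime d`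
(Streater–Wightman (1964), §1-1). [cite: StreaterWightman1964] -/
def lorentzGroup : Subgroup (SpaceTime d ≃L[ℝ] SpaceTime d) where
  carrier := {Λ | ∀ x y, minkowskiForm d (Λ x) (Λ y) = minkowskiForm d x y}
  mul_mem' {Λ Λ'} h h' x y := by
    simp only [Set.mem_setOf_eq] at h h'
    rw [continuousLinearEquiv_mul_apply, continuousLinearEquiv_mul_apply, h, h']
  one_mem' x y := rfl
  inv_mem' {Λ} h x y := by
    simp only [Set.mem_setOf_eq] at h
    rw [← h (Λ⁻¹ x) (Λ⁻¹ y), continuousLinearEquiv_apply_inv_apply,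
      continuousLinearEquiv_apply_inv_apply]

/-- Membership in the Lorentz group: `Λ` preserves `η`. [folklore] -/
@[simp]
theorem mem_lorentzGroup_iff (Λ : SpaceTime d ≃L[ℝ] SpaceTime d) :
    Λ ∈ lorentzGroup d ↔ ∀ x y, minkowskiForm d (Λ x) (Λ y) = minkowskiForm d x y := Iff.rfl

/-- For a Lorentz transformation, `η(Λ x, y) = η(x, Λ⁻¹ y)`. [folklore] -/
theorem minkowskiForm_apply_left_of_mem_lorentzGroup {Λ : SpaceTime d ≃L[ℝ] SpaceTime d}
    (h : Λ ∈ lorentzGroup d) (x y : SpaceTime d) :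
    minkowskiForm d (Λ x) y = minkowskiForm d x (Λ⁻¹ y) := by
  conv_lhs => rw [← continuousLinearEquiv_apply_inv_apply Λ y]
  exact h x (Λ⁻¹ y)

/-- A continuous linear automorphism is *orthochronous* if it maps `e₀` into the future:
`(Λ e₀)⁰ > 0` (Streater–Wightman (1964), §1-1). [cite: StreaterWightman1964] -/
def IsOrthochronous (Λ : SpaceTime d ≃L[ℝ] SpaceTime d) : Prop := 0 < Λ (e₀ d) 0

/-- A continuous linear automorphism is *proper* if `det Λ = 1`
(Streater–Wightman (1964), §1-1). [cite: StreaterWightman1964] -/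
def IsProper (Λ : SpaceTime d ≃L[ℝ] SpaceTime d) : Prop :=
  LinearMap.det ((Λ : SpaceTime d →L[ℝ] SpaceTime d) : SpaceTime d →ₗ[ℝ] SpaceTime d) = 1

variable (d) in
/-- The determinant as a monoid homomorphism on continuous linear automorphisms of space-time
(Mathlib: `LinearMap.det`, `LinearMap.det_comp`). [folklore] -/
def detHom : (SpaceTime d ≃L[ℝ] SpaceTime d) →* ℝ where
  toFun Λ := LinearMap.det ((Λ : SpaceTime d →L[ℝ] SpaceTime d) : SpaceTime d →ₗ[ℝ] SpaceTime d)
  map_one' := LinearMap.det_id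
  map_mul' Λ Λ' := by
    rw [← LinearMap.det_comp]
    rfl

/-- Unfolding lemma for `detHom`. [folklore] -/
@[simp]
theorem detHom_apply (Λ : SpaceTime d ≃L[ℝ] SpaceTime d) :
    detHom d Λ =
      LinearMap.det ((Λ : SpaceTime d →L[ℝ] SpaceTime d) : SpaceTime d →ₗ[ℝ] SpaceTime d) :=
  rfl

/-- `IsProper Λ ↔ Λ ∈ ker detHom`. [folklore] -/
theorem isProper_iff_mem_ker (Λ : SpaceTime d ≃L[ℝ] SpaceTime d) :
    IsProper Λ ↔ Λ ∈ (detHom d).ker := Iff.rfl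

/-- A Lorentz transformation maps the open forward cone to itself iff it is orthochronous; this is
the forward direction for `e₀`-images: `Λ e₀ ∈ V₊` for orthochronous Lorentz `Λ`. [folklore] -/
theorem apply_e₀_mem_forwardCone {Λ : SpaceTime d ≃L[ℝ] SpaceTime d} (h : Λ ∈ lorentzGroup d)
    (ho : IsOrthochronous Λ) : Λ (e₀ d) ∈ forwardCone d :=
  ⟨ho, by rw [h]; simp⟩

/-- The inverse of an orthochronous Lorentz transformation is orthochronous:
`(Λ⁻¹ e₀)⁰ = η(e₀, Λ⁻¹ e₀) = η(Λ e₀, e₀) = (Λ e₀)⁰`. [folklore] -/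
theorem IsOrthochronous.inv {Λ : SpaceTime d ≃L[ℝ] SpaceTime d} (h : Λ ∈ lorentzGroup d)
    (ho : IsOrthochronous Λ) : IsOrthochronous Λ⁻¹ := by
  unfold IsOrthochronous at *
  rw [← minkowskiForm_e₀_left, ← minkowskiForm_apply_left_of_mem_lorentzGroup h,
    minkowskiForm_comm, minkowskiForm_e₀_left]
  exact ho

/-- The product of orthochronous Lorentz transformations is orthochronous (reverse
Cauchy–Schwarz; Streater–Wightman (1964), §1-1). [cite: StreaterWightman1964] -/
theorem IsOrthochronous.mul {Λ Λ' : SpaceTime d ≃L[ℝ] SpaceTime d} (h : Λ ∈ lorentzGroup d)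
    (ho : IsOrthochronous Λ) (h' : Λ' ∈ lorentzGroup d) (ho' : IsOrthochronous Λ') :
    IsOrthochronous (Λ * Λ') := by
  unfold IsOrthochronous
  rw [continuousLinearEquiv_mul_apply, ← minkowskiForm_e₀_left,
    minkowskiForm_comm, minkowskiForm_apply_left_of_mem_lorentzGroup h]
  exact minkowskiForm_pos_of_mem_forwardCone (apply_e₀_mem_forwardCone h' ho')
    (apply_e₀_mem_forwardCone ((lorentzGroup d).inv_mem h) (ho.inv h))

variable (d) in
/-- The **orthochronous Lorentz group** `O↑(1, d) = {Λ ∈ O(1, d) | (Λ e₀)⁰ > 0}`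
(Streater–Wightman (1964), §1-1). [cite: StreaterWightman1964] -/
def orthochronousLorentzGroup : Subgroup (SpaceTime d ≃L[ℝ] SpaceTime d) where
  carrier := {Λ | Λ ∈ lorentzGroup d ∧ IsOrthochronous Λ}
  mul_mem' {Λ Λ'} h h' := ⟨(lorentzGroup d).mul_mem h.1 h'.1, h.2.mul h.1 h'.1 h'.2⟩
  one_mem' := ⟨(lorentzGroup d).one_mem, by simp [IsOrthochronous]⟩
  inv_mem' {Λ} h := ⟨(lorentzGroup d).inv_mem h.1, h.2.inv h.1⟩

/-- Membership in the orthochronous Lorentz group. [folklore] -/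
@[simp]
theorem mem_orthochronousLorentzGroup_iff (Λ : SpaceTime d ≃L[ℝ] SpaceTime d) :
    Λ ∈ orthochronousLorentzGroup d ↔ Λ ∈ lorentzGroup d ∧ IsOrthochronous Λ := Iff.rfl

variable (d) in
/-- The **restricted Lorentz group** `L↑₊ = SO↑(1, d)`: proper orthochronous Lorentz
transformations, the intersection of `orthochronousLorentzGroup d` with the kernel of the
determinant (Streater–Wightman (1964), §1-1). [cite: StreaterWightman1964] -/
def restrictedLorentzGroup : Subgroup (SpaceTime d ≃L[ℝ] SpaceTime d) :=
  orthochronousLorentzGroup d ⊓ (detHom d).ker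

/-- Membership in the restricted Lorentz group. [folklore] -/
theorem mem_restrictedLorentzGroup_iff (Λ : SpaceTime d ≃L[ℝ] SpaceTime d) :
    Λ ∈ restrictedLorentzGroup d ↔ Λ ∈ lorentzGroup d ∧ IsOrthochronous Λ ∧ IsProper Λ := by
  simp only [restrictedLorentzGroup, Subgroup.mem_inf, mem_orthochronousLorentzGroup_iff,
    isProper_iff_mem_ker, and_assoc]

/-- The restricted Lorentz group is contained in the Lorentz group. [folklore] -/
theorem restrictedLorentzGroup_le_lorentzGroup : restrictedLorentzGroup d ≤ lorentzGroup d :=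
  fun _ h => ((mem_restrictedLorentzGroup_iff _).1 h).1

/-! ### Boosts and spatial rotations -/

/-- The linear map underlying the boost of rapidity `χ` in the `i`-th spatial direction:
`x⁰ ↦ cosh χ x⁰ + sinh χ xⁱ`, `xⁱ ↦ sinh χ x⁰ + cosh χ xⁱ`, other coordinates fixed
(Streater–Wightman (1964), §1-3). [cite: StreaterWightman1964] -/
def boostLin (i : Fin d) (χ : ℝ) : SpaceTime d →ₗ[ℝ] SpaceTime d where
  toFun x := WithLp.toLp 2 fun j =>
    if j = 0 then Real.cosh χ * x 0 + Real.sinh χ * x i.succ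
    else if j = i.succ then Real.sinh χ * x 0 + Real.cosh χ * x i.succ else x j
  map_add' x y := by
    ext j
    simp only [PiLp.add_apply]
    split_ifs <;> ring
  map_smul' c x := by
    ext j
    simp only [PiLp.smul_apply, smul_eq_mul, RingHom.id_apply]
    split_ifs <;> ring

/-- Coordinates of `boostLin`. [folklore] -/
@[simp]
theorem boostLin_apply (i : Fin d) (χ : ℝ) (x : SpaceTime d) (j : Fin (d + 1)) :
    boostLin i χ x j =
      if j = 0 then Real.cosh χ * x 0 + Real.sinh χ * x i.succ
      else if j = i.succ then Real.sinh χ * x 0 + Real.cosh χ * x i.succ else x j :=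
  rfl

/-- `boostLin i (-χ)` is a left inverse of `boostLin i χ` (`cosh² − sinh² = 1`). [folklore] -/
theorem boostLin_neg_apply_boostLin (i : Fin d) (χ : ℝ) (x : SpaceTime d) :
    boostLin i (-χ) (boostLin i χ x) = x := by
  have h := Real.cosh_sq χ
  ext j
  simp only [boostLin_apply, Real.cosh_neg, Real.sinh_neg, if_true, Fin.succ_ne_zero, if_false]
  split_ifs with h0 hi
  · subst h0; linear_combination (x 0) * h
  · subst hi; linear_combination (x i.succ) * h
  · rfl

/-- The **boost** of rapidity `χ` in the `i`-th spatial direction, as a continuous linear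
automorphism of space-time (Streater–Wightman (1964), §1-3). [cite: StreaterWightman1964] -/
def boost (i : Fin d) (χ : ℝ) : SpaceTime d ≃L[ℝ] SpaceTime d :=
  ContinuousLinearEquiv.equivOfInverse (LinearMap.toContinuousLinearMap (boostLin i χ))
    (LinearMap.toContinuousLinearMap (boostLin i (-χ)))
    (boostLin_neg_apply_boostLin i χ) (fun x => by simpa using boostLin_neg_apply_boostLin i (-χ) x)

/-- Coordinates of a boost. [folklore] -/
@[simp]
theorem boost_apply (i : Fin d) (χ : ℝ) (x : SpaceTime d) : boost i χ x = boostLin i χ x := rfl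

/-- Boosts are restricted Lorentz transformations (Streater–Wightman (1964), §1-3). [cite: StreaterWightman1964] -/
def boost_mem_restrictedLorentzGroup : Prop :=
  ∀ (i : Fin d) (χ : ℝ),
    boost i χ ∈ restrictedLorentzGroup d

/-- Boosts in a fixed direction form a one-parameter group: `B(χ) B(χ') = B(χ + χ')`
(Streater–Wightman (1964), §1-3). [cite: StreaterWightman1964] -/
def boost_add : Prop :=
  ∀ (i : Fin d) (χ χ' : ℝ),
    boost i (χ + χ') = boost i χ * boost i χ'

/-- Embed a continuous linear automorphism `R` of space `ℝ^d` as the space-time automorphism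
`(x⁰, x⃗) ↦ (x⁰, R x⃗)`; the underlying continuous linear map. [folklore] -/
def spatialCLM (R : EuclideanSpace ℝ (Fin d) →L[ℝ] EuclideanSpace ℝ (Fin d)) :
    SpaceTime d →L[ℝ] SpaceTime d :=
  LinearMap.toContinuousLinearMap
    { toFun := fun x => ofTimeSpace (timeC x) (R (spaceC d x))
      map_add' := fun x y => by
        ext j; refine Fin.cases ?_ (fun k => ?_) j <;> simp
      map_smul' := fun c x => by
        ext j; refine Fin.cases ?_ (fun k => ?_) j <;> simp }

/-- Unfolding lemma for `spatialCLM`. [folklore] -/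
@[simp]
theorem spatialCLM_apply (R : EuclideanSpace ℝ (Fin d) →L[ℝ] EuclideanSpace ℝ (Fin d))
    (x : SpaceTime d) : spatialCLM R x = ofTimeSpace (timeC x) (R (spaceC d x)) := rfl

/-- The **spatial rotation** embedding: a continuous linear automorphism `R` of space `ℝ^d` acts
on space-time by `(x⁰, x⃗) ↦ (x⁰, R x⃗)` (Streater–Wightman (1964), §1-3; for `R ∈ SO(d)` this is
a restricted Lorentz transformation, `spatialRotation_mem_restrictedLorentzGroup`). [cite: StreaterWightman1964] -/
def spatialRotation (R : EuclideanSpace ℝ (Fin d) ≃L[ℝ] EuclideanSpace ℝ (Fin d)) :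
    SpaceTime d ≃L[ℝ] SpaceTime d :=
  ContinuousLinearEquiv.equivOfInverse (spatialCLM R) (spatialCLM R.symm)
    (fun x => by simp) (fun x => by simp)

/-- Unfolding lemma for `spatialRotation`. [folklore] -/
@[simp]
theorem spatialRotation_apply (R : EuclideanSpace ℝ (Fin d) ≃L[ℝ] EuclideanSpace ℝ (Fin d))
    (x : SpaceTime d) : spatialRotation R x = ofTimeSpace (timeC x) (R (spaceC d x)) := rfl

/-- `spatialRotation` is a group homomorphism. [folklore] -/
theorem spatialRotation_mul (R R' : EuclideanSpace ℝ (Fin d) ≃L[ℝ] EuclideanSpace ℝ (Fin d)) :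
    spatialRotation (R * R') = spatialRotation R * spatialRotation R' := by
  apply ContinuousLinearEquiv.ext
  funext x
  simp

/-- A linear isometry of space embeds as a Lorentz transformation. [folklore] -/
theorem spatialRotation_mem_lorentzGroup (R : EuclideanSpace ℝ (Fin d) ≃ₗᵢ[ℝ] EuclideanSpace ℝ (Fin d)) :
    spatialRotation R.toContinuousLinearEquiv ∈ lorentzGroup d := by
  intro x y
  rw [minkowskiForm_eq_inner, minkowskiForm_eq_inner]
  simp [LinearIsometryEquiv.inner_map_map]

/-- A rotation of space (a linear isometry of determinant `1`, i.e. an element of `SO(d)`) embeds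
as a restricted Lorentz transformation (Streater–Wightman (1964), §1-3). [cite: StreaterWightman1964] -/
def spatialRotation_mem_restrictedLorentzGroup : Prop :=
  ∀ (R : EuclideanSpace ℝ (Fin d) ≃ₗᵢ[ℝ] EuclideanSpace ℝ (Fin d)) (hR : LinearMap.det (R.toLinearEquiv : EuclideanSpace ℝ (Fin d) →ₗ[ℝ] EuclideanSpace ℝ (Fin d)) = 1),
    spatialRotation R.toContinuousLinearEquiv ∈ restrictedLorentzGroup d

/-! ### The Poincaré group -/

variable (d) in
/-- The action of the restricted Lorentz group on the translation group
`Multiplicative (SpaceTime d)` by automorphisms, `Λ ↦ (a ↦ Λ a)`; the twisting homomorphism of the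
semidirect product `PoincareGroup d` (Streater–Wightman (1964), §1-1, eq. (1-6)). [cite: StreaterWightman1964] -/
def lorentzAct : restrictedLorentzGroup d →* MulAut (Multiplicative (SpaceTime d)) where
  toFun Λ := AddEquiv.toMultiplicative
    ((Λ : SpaceTime d ≃L[ℝ] SpaceTime d).toLinearEquiv.toAddEquiv)
  map_one' := rfl
  map_mul' _ _ := rfl

/-- Unfolding lemma for `lorentzAct`. [folklore] -/
@[simp]
theorem lorentzAct_apply (Λ : restrictedLorentzGroup d) (a : Multiplicative (SpaceTime d)) :
    lorentzAct d Λ a = Multiplicative.ofAdd ((Λ : SpaceTime d ≃L[ℝ] SpaceTime d) a.toAdd) := rfl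

/-- Unfolding lemma for the inverse of `lorentzAct Λ`. [folklore] -/
@[simp]
theorem lorentzAct_symm_apply (Λ : restrictedLorentzGroup d) (a : Multiplicative (SpaceTime d)) :
    (lorentzAct d Λ).symm a =
      Multiplicative.ofAdd ((Λ : SpaceTime d ≃L[ℝ] SpaceTime d).symm a.toAdd) := rfl

variable (d) in
/-- The (restricted) **Poincaré group** `ℝ^{1+d} ⋊ L↑₊`, as a Mathlib semidirect product of the
translation group (written multiplicatively) by the restricted Lorentz group; no topology is put
on it (outline A-D4) (Streater–Wightman (1964), §1-1, eq. (1-6)). [cite: StreaterWightman1964] -/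
abbrev PoincareGroup : Type :=
  Multiplicative (SpaceTime d) ⋊[lorentzAct d] restrictedLorentzGroup d

/-- The action of the Poincaré group on space-time, `(a, Λ) • x = Λ x + a`
(Streater–Wightman (1964), §1-1, eq. (1-5)). [cite: StreaterWightman1964] -/
def poincareAct (g : PoincareGroup d) (x : SpaceTime d) : SpaceTime d :=
  (g.right : SpaceTime d ≃L[ℝ] SpaceTime d) x + g.left.toAdd

/-- The Poincaré action is a group action: `(g h) • x = g • (h • x)`
(Streater–Wightman (1964), eq. (1-6)). [cite: StreaterWightman1964] -/
theorem poincareAct_mul (g h : PoincareGroup d) (x : SpaceTime d) :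
    poincareAct (g * h) x = poincareAct g (poincareAct h x) := by
  simp only [poincareAct, SemidirectProduct.mul_right, SemidirectProduct.mul_left,
    Subgroup.coe_mul, continuousLinearEquiv_mul_apply, lorentzAct_apply, toAdd_mul, toAdd_ofAdd,
    map_add]
  abel

/-- The identity acts trivially. [folklore] -/
@[simp]
theorem poincareAct_one (x : SpaceTime d) : poincareAct (1 : PoincareGroup d) x = x := by
  simp [poincareAct]

/-- A pure translation acts by `x ↦ x + a`. [folklore] -/
@[simp]
theorem poincareAct_inl (a : SpaceTime d) (x : SpaceTime d) :
    poincareAct (SemidirectProduct.inl (Multiplicative.ofAdd a) : PoincareGroup d) x = x + a := by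
  simp [poincareAct]

/-- A pure Lorentz transformation acts by `x ↦ Λ x`. [folklore] -/
@[simp]
theorem poincareAct_inr (Λ : restrictedLorentzGroup d) (x : SpaceTime d) :
    poincareAct (SemidirectProduct.inr Λ : PoincareGroup d) x
      = (Λ : SpaceTime d ≃L[ℝ] SpaceTime d) x := by
  simp [poincareAct]

/-- The Poincaré action preserves spacelike separation. [folklore] -/
theorem IsSpacelikeSeparated.poincareAct {x y : SpaceTime d} (h : IsSpacelikeSeparated x y)
    (g : PoincareGroup d) : IsSpacelikeSeparated (poincareAct g x) (poincareAct g y) := by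
  have hΛ : (g.right : SpaceTime d ≃L[ℝ] SpaceTime d) ∈ lorentzGroup d :=
    restrictedLorentzGroup_le_lorentzGroup g.right.2
  unfold IsSpacelikeSeparated IsSpacelike at *
  simpa only [Literature.MathematicalPhysics.QuantumLattice.poincareAct, add_sub_add_right_eq_sub, ← map_sub, hΛ (x - y) (x - y)]
    using h

/-! ### Action on test functions -/

/-- The action of the Poincaré group on Schwartz test functions on space-time,
`(g • f)(x) = f(g⁻¹ • x) = f(Λ⁻¹ (x − a))` for `g = (a, Λ)`, as a continuous `ℂ`-linear map
(Mathlib: `SchwartzMap.compSubConstCLM ∘ SchwartzMap.compCLMOfContinuousLinearEquiv`;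
Streater–Wightman (1964), §3-1, axiom W2). [cite: StreaterWightman1964] -/
def poincareTest (g : PoincareGroup d) : 𝓢(SpaceTime d, ℂ) →L[ℂ] 𝓢(SpaceTime d, ℂ) :=
  (SchwartzMap.compSubConstCLM ℂ g.left.toAdd).comp
    (SchwartzMap.compCLMOfContinuousLinearEquiv ℂ
      ((g.right : SpaceTime d ≃L[ℝ] SpaceTime d).symm))

/-- Pointwise formula: `poincareTest g f x = f (Λ⁻¹ (x − a))`. [folklore] -/
@[simp]
theorem poincareTest_apply (g : PoincareGroup d) (f : 𝓢(SpaceTime d, ℂ)) (x : SpaceTime d) :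
    poincareTest g f x = f ((g.right : SpaceTime d ≃L[ℝ] SpaceTime d).symm (x - g.left.toAdd)) :=
  rfl

/-- `poincareTest g f x = f (g⁻¹ • x)`. [folklore] -/
theorem poincareTest_apply_eq_poincareAct_inv (g : PoincareGroup d) (f : 𝓢(SpaceTime d, ℂ))
    (x : SpaceTime d) : poincareTest g f x = f (poincareAct g⁻¹ x) := by
  simp [poincareAct, continuousLinearEquiv_inv_def, sub_eq_add_neg]

/-- `poincareTest` is a left action: `poincareTest (g h) = poincareTest g ∘ poincareTest h`. [folklore] -/
theorem poincareTest_mul (g h : PoincareGroup d) :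
    poincareTest (g * h) = (poincareTest g).comp (poincareTest h) := by
  ext f x
  simp only [poincareTest_apply, ContinuousLinearMap.comp_apply, SemidirectProduct.mul_left,
    SemidirectProduct.mul_right, Subgroup.coe_mul, lorentzAct_apply, toAdd_mul, toAdd_ofAdd]
  congr 1
  simp [← continuousLinearEquiv_inv_def, map_sub, sub_sub]

/-- The diagonal action of `Λ⁻¹` on `n`-tuples of space-time points, as a continuous linear
equivalence of `Fin n → SpaceTime d` (Mathlib: `ContinuousLinearEquiv.piCongrRight`). [folklore] -/
def lorentzDiag (n : ℕ) (Λ : SpaceTime d ≃L[ℝ] SpaceTime d) :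
    (Fin n → SpaceTime d) ≃L[ℝ] (Fin n → SpaceTime d) :=
  ContinuousLinearEquiv.piCongrRight fun _ => Λ

/-- Unfolding lemma for `lorentzDiag`. [folklore] -/
@[simp]
theorem lorentzDiag_apply (n : ℕ) (Λ : SpaceTime d ≃L[ℝ] SpaceTime d) (x : Fin n → SpaceTime d)
    (k : Fin n) : lorentzDiag n Λ x k = Λ (x k) := rfl

/-- The diagonal action of the Poincaré group on Schwartz test functions of `n` space-time
arguments, `(g • f)(x₁, …, xₙ) = f(g⁻¹ • x₁, …, g⁻¹ • xₙ)` (Streater–Wightman (1964), §3-1,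
§3-3, covariance of Wightman distributions). [cite: StreaterWightman1964] -/
def poincareTestMulti (n : ℕ) (g : PoincareGroup d) :
    𝓢((Fin n → SpaceTime d), ℂ) →L[ℂ] 𝓢((Fin n → SpaceTime d), ℂ) :=
  (SchwartzMap.compSubConstCLM ℂ (fun _ : Fin n => g.left.toAdd)).comp
    (SchwartzMap.compCLMOfContinuousLinearEquiv ℂ
      (lorentzDiag n (g.right : SpaceTime d ≃L[ℝ] SpaceTime d).symm))

/-- Pointwise formula: `poincareTestMulti n g f x = f (fun k => Λ⁻¹ (x k − a))`. [folklore] -/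
@[simp]
theorem poincareTestMulti_apply (n : ℕ) (g : PoincareGroup d) (f : 𝓢((Fin n → SpaceTime d), ℂ))
    (x : Fin n → SpaceTime d) :
    poincareTestMulti n g f x =
      f (fun k => (g.right : SpaceTime d ≃L[ℝ] SpaceTime d).symm (x k - g.left.toAdd)) :=
  rfl

/-- `poincareTestMulti` is a left action. [folklore] -/
theorem poincareTestMulti_mul (n : ℕ) (g h : PoincareGroup d) :
    poincareTestMulti n (g * h) = (poincareTestMulti n g).comp (poincareTestMulti n h) := by
  ext f x
  simp only [poincareTestMulti_apply, ContinuousLinearMap.comp_apply, SemidirectProduct.mul_left,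
    SemidirectProduct.mul_right, Subgroup.coe_mul, lorentzAct_apply, toAdd_mul, toAdd_ofAdd]
  congr 1
  funext k
  simp [← continuousLinearEquiv_inv_def, map_sub, sub_sub]

end Literature.MathematicalPhysics.QuantumLattice
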